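import Summits.QuantumAdvantage.QuantumAdvantage.Theorems.CubicForrelationSignedExactCubicForrelationNotPrBPPStubNoTrapTransportLemmas
import Summits.QuantumAdvantage.QuantumAdvantage.Theorems.CubicForrelationNearExactIsExactUniformRowDefect

/-!
# Crux `CubicForrelation.SignedExactCubicForrelationNotPrBPP` (stmt-QuantumAdvantage-13932), line `dual-pingpong-frame`
# (classify-then-count cut), stub `stub_coreReduction` — brick (i): ORBIT TRANSPORT OF THE GOOD MASS

Support file (`--supports stmt-QuantumAdvantage-13932`). The kernel statistic of the GROW finder — the good mass
`goodMass f S U r = ∑_{xs} |{v ∈ K_f(S,U,xs) : v ∉ S, v good}| / |K_f(S,U,xs)|` (candidate space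
`K_f(S,U,xs) = Z_f(S) ∩ U^⊥ ∩ ⋂ⱼ rad B_{xⱼ}`, `v` good iff some M-subspace of `f` contains `S` and `v` and is
orthogonal to `U`) — is COVARIANT under the coupled affine disguise of the line: for `f₀ x = f (P x ⊕ z₀) ⊕ λ x`
with `P` an additive bijection (inverse `P⁻¹`, adjoint `Q`: `P x · y = x · Q y`) and `λ` additive, and for pairs
`(A, B)`, `(A₀, B₀)` with `A₀ = P⁻¹ A` and `B₀ = Q B`,

  `goodMass f₀ A₀ B₀ r = goodMass f A B r`   for every number of probes `r`.

Proof: second differences are covariant (`Covariance.D2_transport`, landed), so `v ∈ K_{f₀}(A₀,B₀,xs)` iff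
`P v ∈ K_f(A,B,P∘xs)`; M-subspaces map to M-subspaces under `P` and `P⁻¹` (cardinality by injectivity, flatness by
covariance, orthogonality by the adjoint identity), so `v` is new-good for `f₀` iff `P v` is new-good for `f`; hence
both finsets at `xs` are the `P⁻¹`-images of those at `P ∘ xs`, the quotients agree termwise, and `xs ↦ P ∘ xs` is a
bijection of probe tuples. Everything is stated in the tree vocabulary of the registered stubs (second differences
enter the lemmas as a function parameter `D` with its defining equation, as in `…StubNoTrapTransportLemmas.lean`).

* `Covariance.kconds_transport` — the three candidate-space clauses are covariant;
* `Covariance.flat_image`, `Covariance.card_sq_image`, `Covariance.good_transport` — M-subspaces and goodness;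
* `Covariance.goodMass_transport_D` — the good mass identity with `D`-parameters;
* `goodMass_transport` / `coreReduction_goodMassTransport` — the identity in fully unfolded tree vocabulary
  (the latter is the registered one-line form).

References: C. Carlet, *Boolean Functions for Cryptography and Coding Theory*, CUP 2021, §2.2.2 (affine
equivalence, derivatives), Prop. 54 [Carlet2020]; R. O'Donnell, *Analysis of Boolean Functions*, CUP 2014, §1.4,
§3.3 [ODonnell2014]. -/

noncomputable section

set_option linter.dupNamespace false -- D-0017: single-problem summit ⇒ `QuantumAdvantage.QuantumAdvantage` by design

namespace Summit.QuantumAdvantage.QuantumAdvantage.Theorems.SignedExactCubicForrelationNotPrBPP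

open Finset
open Literature.Computability.Complexity Literature.Computability.QuantumComplexity
open Literature.Computability.QuantumComplexity.BuzetChailloux (bxor zeroVec bxor_self bxor_comm bxor_zeroVec zeroVec_bxor)
open PolarGeometry (bdot_comm bdot_bxor_left bdot_bxor_right)
open Summit.QuantumAdvantage.QuantumAdvantage.Theorems.CubicForrelation.NearExactIsExact (ur_bxor_cancel_right)
open Covariance

namespace Covariance

variable {n : ℕ}

/-! ### Bit-vector bookkeeping -/

/-- `((x ⊕ z) ⊕ y) ⊕ z = x ⊕ y`. [folklore] -/
theorem bxor_bxor_bxor_cancel_mid (x y z : Fin n → Bool) : bxor (bxor (bxor x z) y) z = bxor x y := by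
  funext i
  show (((x i ^^ z i) ^^ y i) ^^ z i) = (x i ^^ y i)
  cases x i <;> cases y i <;> cases z i <;> rfl

/-- The inverse of an additive bijection sends `0` to `0`. [folklore] -/
theorem inv_zeroVec {P Pi : (Fin n → Bool) → (Fin n → Bool)} (hP : ∀ x y, P (bxor x y) = bxor (P x) (P y))
    (hPiP : ∀ x, Pi (P x) = x) : Pi zeroVec = zeroVec := by
  have h := map_zeroVec hP
  have := congrArg Pi h
  rw [hPiP] at this
  exact this.symm

/-! ### Covariance of the candidate space -/

/-- **The candidate-space clauses are covariant.** With `D₀ u v x = D (P u) (P v) (P x ⊕ z₀)` (second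
differences of `f₀ x = f (P x ⊕ z₀) ⊕ λ x`), `P` an additive bijection with inverse `P⁻¹` and adjoint `Q`, and
`A₀ = P⁻¹ A`, `B₀ = Q B`: `v` satisfies the three clauses of `K_{f₀}(A₀, B₀, xs)` iff `P v` satisfies those of
`K_f(A, B, P ∘ xs)`. [cite: Carlet2020, §2.2.2] -/
theorem kconds_transport (D D₀ : (Fin n → Bool) → (Fin n → Bool) → (Fin n → Bool) → Bool)
    {P Pi Q : (Fin n → Bool) → (Fin n → Bool)} {z₀ : Fin n → Bool}
    (H : ∀ u v x, D₀ u v x = D (P u) (P v) (bxor (P x) z₀))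
    (hP : ∀ x y, P (bxor x y) = bxor (P x) (P y)) (hPPi : ∀ x, P (Pi x) = x)
    (hQ : ∀ x y, (univ.filter fun i => P x i && y i).card.bodd = (univ.filter fun i => x i && Q y i).card.bodd)
    {A B A₀ B₀ : Finset (Fin n → Bool)} (hA₀ : ∀ v, v ∈ A₀ ↔ P v ∈ A)
    (hB₁ : ∀ u ∈ B, Q u ∈ B₀) (hB₂ : ∀ u ∈ B₀, ∃ u' ∈ B, Q u' = u)
    {r : ℕ} (xs : Fin r → (Fin n → Bool)) (v : Fin n → Bool) :
    ((∀ s ∈ A₀, ∀ x, D₀ s v x = false) ∧ (∀ u ∈ B₀, (univ.filter fun i => u i && v i).card.bodd = false) ∧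
      ∀ j, ∀ y z : Fin n → Bool, (D₀ (xs j) v z ^^ D₀ (xs j) v (bxor z y)) = false) ↔
    ((∀ s ∈ A, ∀ x, D s (P v) x = false) ∧ (∀ u ∈ B, (univ.filter fun i => u i && P v i).card.bodd = false) ∧
      ∀ j, ∀ y z : Fin n → Bool, (D (P (xs j)) (P v) z ^^ D (P (xs j)) (P v) (bxor z y)) = false) := by
  have hdot : ∀ u, (univ.filter fun i => Q u i && v i).card.bodd = (univ.filter fun i => u i && P v i).card.bodd :=
    fun u => by rw [bdot_comm, ← hQ, bdot_comm]
  constructor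
  · rintro ⟨h1, h2, h3⟩
    refine ⟨fun s hs x => ?_, fun u hu => ?_, fun j y z => ?_⟩
    · have hs' : Pi s ∈ A₀ := (hA₀ _).2 (by rw [hPPi]; exact hs)
      have := h1 (Pi s) hs' (Pi (bxor x z₀))
      rwa [H, hPPi, hPPi, ur_bxor_cancel_right] at this
    · have := h2 (Q u) (hB₁ u hu)
      rwa [hdot] at this
    · have := h3 j (Pi y) (Pi (bxor z z₀))
      rwa [H, H, hP, hPPi, hPPi, ur_bxor_cancel_right, bxor_bxor_bxor_cancel_mid] at this
  · rintro ⟨h1, h2, h3⟩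
    refine ⟨fun s hs x => ?_, fun u hu => ?_, fun j y z => ?_⟩
    · rw [H]; exact h1 (P s) ((hA₀ s).1 hs) _
    · obtain ⟨u', hu', rfl⟩ := hB₂ u hu
      rw [hdot]; exact h2 u' hu'
    · rw [H, H, hP]
      have := h3 j (P y) (bxor (P z) z₀)
      rwa [show bxor (bxor (P z) z₀) (P y) = bxor (bxor (P z) (P y)) z₀ from by
        funext i
        show ((P z i ^^ z₀ i) ^^ P y i) = ((P z i ^^ P y i) ^^ z₀ i)
        cases P z i <;> cases z₀ i <;> cases P y i <;> rfl] at this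

/-! ### Covariance of M-subspaces and of goodness -/

/-- Flatness is covariant: if `D' (R u) (R v) x = D u v (T x)` then the `R`-image of a `D`-flat finset is `D'`-flat.
[cite: Carlet2020, §2.2.2] -/
theorem flat_image (D D' : (Fin n → Bool) → (Fin n → Bool) → (Fin n → Bool) → Bool)
    (R T : (Fin n → Bool) → (Fin n → Bool)) (HR : ∀ u v x, D' (R u) (R v) x = D u v (T x))
    {V : Finset (Fin n → Bool)} (hV : ∀ u ∈ V, ∀ v ∈ V, ∀ x, D u v x = false) :
    ∀ u ∈ V.image R, ∀ v ∈ V.image R, ∀ x, D' u v x = false := by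
  intro u hu v hv x
  obtain ⟨u₀, hu₀, rfl⟩ := mem_image.1 hu
  obtain ⟨v₀, hv₀, rfl⟩ := mem_image.1 hv
  rw [HR]
  exact hV u₀ hu₀ v₀ hv₀ _

/-- The image of a finset under an injective map has the same `|·|² = 2ⁿ` bookkeeping. [folklore] -/
theorem card_sq_image {R : (Fin n → Bool) → (Fin n → Bool)} (hR : Function.Injective R)
    {V : Finset (Fin n → Bool)} (hV : ((V.card : ℝ)) ^ 2 = (2 : ℝ) ^ n) :
    (((V.image R).card : ℝ)) ^ 2 = (2 : ℝ) ^ n := by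
  rw [card_image_of_injective _ hR]; exact hV

/-- **Goodness is covariant.** With the data of `kconds_transport` (and `P⁻¹ ∘ P = id`), `v` lies in an M-subspace
of `f₀` through `A₀` orthogonal to `B₀` iff `P v` lies in an M-subspace of `f` through `A` orthogonal to `B`
(images under `P`, resp. `P⁻¹`). [cite: Carlet2020, Prop. 54] -/
theorem good_transport (D D₀ : (Fin n → Bool) → (Fin n → Bool) → (Fin n → Bool) → Bool)
    {P Pi Q : (Fin n → Bool) → (Fin n → Bool)} {z₀ : Fin n → Bool}
    (H : ∀ u v x, D₀ u v x = D (P u) (P v) (bxor (P x) z₀))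
    (hP : ∀ x y, P (bxor x y) = bxor (P x) (P y)) (hPPi : ∀ x, P (Pi x) = x) (hPiP : ∀ x, Pi (P x) = x)
    (hQ : ∀ x y, (univ.filter fun i => P x i && y i).card.bodd = (univ.filter fun i => x i && Q y i).card.bodd)
    {A B A₀ B₀ : Finset (Fin n → Bool)} (hA₀ : ∀ v, v ∈ A₀ ↔ P v ∈ A)
    (hB₁ : ∀ u ∈ B, Q u ∈ B₀) (hB₂ : ∀ u ∈ B₀, ∃ u' ∈ B, Q u' = u) (v : Fin n → Bool) :
    (∃ V : Finset (Fin n → Bool), ((zeroVec ∈ V ∧ ∀ x ∈ V, ∀ y ∈ V, bxor x y ∈ V) ∧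
        (((V.card : ℝ)) ^ 2 = (2 : ℝ) ^ n) ∧ ∀ u ∈ V, ∀ w ∈ V, ∀ x, D₀ u w x = false) ∧
        A₀ ⊆ V ∧ v ∈ V ∧ ∀ s ∈ V, ∀ u ∈ B₀, (univ.filter fun i => s i && u i).card.bodd = false) ↔
    (∃ V : Finset (Fin n → Bool), ((zeroVec ∈ V ∧ ∀ x ∈ V, ∀ y ∈ V, bxor x y ∈ V) ∧
        (((V.card : ℝ)) ^ 2 = (2 : ℝ) ^ n) ∧ ∀ u ∈ V, ∀ w ∈ V, ∀ x, D u w x = false) ∧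
        A ⊆ V ∧ P v ∈ V ∧ ∀ s ∈ V, ∀ u ∈ B, (univ.filter fun i => s i && u i).card.bodd = false) := by
  have hPi : ∀ x y, Pi (bxor x y) = bxor (Pi x) (Pi y) := inverse_additive hP hPPi hPiP
  have hPinj : Function.Injective P := fun x y h => by
    have := congrArg Pi h; rwa [hPiP, hPiP] at this
  have hPiinj : Function.Injective Pi := fun x y h => by
    have := congrArg P h; rwa [hPPi, hPPi] at this
  -- the two covariance identities for flatness
  have HP : ∀ u w x, D (P u) (P w) x = D₀ u w (Pi (bxor x z₀)) := fun u w x => by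
    rw [H, hPPi, ur_bxor_cancel_right]
  have HPi : ∀ u w x, D₀ (Pi u) (Pi w) x = D u w (bxor (P x) z₀) := fun u w x => by
    rw [H, hPPi, hPPi]
  constructor
  · rintro ⟨V, ⟨hVs, hVc, hVf⟩, hAV, hvV, hVB⟩
    refine ⟨V.image P, ⟨isSub_image hP hVs, card_sq_image hPinj hVc, flat_image D₀ D P _ HP hVf⟩, ?_,
      mem_image_of_mem P hvV, ?_⟩
    · intro a ha
      have : Pi a ∈ A₀ := (hA₀ _).2 (by rw [hPPi]; exact ha)
      exact mem_image.2 ⟨Pi a, hAV this, hPPi a⟩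
    · intro s hs u hu
      obtain ⟨s₀, hs₀, rfl⟩ := mem_image.1 hs
      rw [hQ]
      exact hVB s₀ hs₀ (Q u) (hB₁ u hu)
  · rintro ⟨V, ⟨hVs, hVc, hVf⟩, hAV, hvV, hVB⟩
    refine ⟨V.image Pi, ⟨isSub_image hPi hVs, card_sq_image hPiinj hVc, flat_image D D₀ Pi _ HPi hVf⟩, ?_,
      mem_image.2 ⟨P v, hvV, hPiP v⟩, ?_⟩
    · intro a ha
      exact mem_image.2 ⟨P a, hAV ((hA₀ a).1 ha), hPiP a⟩
    · intro s hs u hu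
      obtain ⟨s₀, hs₀, rfl⟩ := mem_image.1 hs
      obtain ⟨u', hu', rfl⟩ := hB₂ u hu
      have e : (univ.filter fun i => Pi s₀ i && Q u' i).card.bodd = (univ.filter fun i => s₀ i && u' i).card.bodd := by
        rw [← hQ, hPPi]
      rw [e]
      exact hVB s₀ hs₀ u' hu'

/-! ### The good mass identity -/

/-- **Orbit transport of the good mass** (`D`-parameter form). [cite: Carlet2020, §2.2.2] -/
theorem goodMass_transport_D (D D₀ : (Fin n → Bool) → (Fin n → Bool) → (Fin n → Bool) → Bool)
    {P Pi Q : (Fin n → Bool) → (Fin n → Bool)} {z₀ : Fin n → Bool}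
    (H : ∀ u v x, D₀ u v x = D (P u) (P v) (bxor (P x) z₀))
    (hP : ∀ x y, P (bxor x y) = bxor (P x) (P y)) (hPPi : ∀ x, P (Pi x) = x) (hPiP : ∀ x, Pi (P x) = x)
    (hQ : ∀ x y, (univ.filter fun i => P x i && y i).card.bodd = (univ.filter fun i => x i && Q y i).card.bodd)
    {A B A₀ B₀ : Finset (Fin n → Bool)} (hA₀ : ∀ v, v ∈ A₀ ↔ P v ∈ A)
    (hB₁ : ∀ u ∈ B, Q u ∈ B₀) (hB₂ : ∀ u ∈ B₀, ∃ u' ∈ B, Q u' = u) (r : ℕ) :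
    (∑ xs : Fin r → (Fin n → Bool),
      (((@Finset.filter (Fin n → Bool) (fun v => v ∉ A₀ ∧ ∃ V : Finset (Fin n → Bool),
          ((zeroVec ∈ V ∧ ∀ x ∈ V, ∀ y ∈ V, bxor x y ∈ V) ∧ (((V.card : ℝ)) ^ 2 = (2 : ℝ) ^ n) ∧
            ∀ u ∈ V, ∀ w ∈ V, ∀ x, D₀ u w x = false) ∧ A₀ ⊆ V ∧ v ∈ V ∧
          ∀ s ∈ V, ∀ u ∈ B₀, (univ.filter fun i => s i && u i).card.bodd = false) (Classical.decPred _)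
        (univ.filter fun v : Fin n → Bool => (∀ s ∈ A₀, ∀ x, D₀ s v x = false) ∧
          (∀ u ∈ B₀, (univ.filter fun i => u i && v i).card.bodd = false) ∧
          ∀ j, ∀ y z : Fin n → Bool, (D₀ (xs j) v z ^^ D₀ (xs j) v (bxor z y)) = false)).card : ℝ) /
      ((univ.filter fun v : Fin n → Bool => (∀ s ∈ A₀, ∀ x, D₀ s v x = false) ∧
          (∀ u ∈ B₀, (univ.filter fun i => u i && v i).card.bodd = false) ∧
          ∀ j, ∀ y z : Fin n → Bool, (D₀ (xs j) v z ^^ D₀ (xs j) v (bxor z y)) = false).card : ℝ))) =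
    (∑ xs : Fin r → (Fin n → Bool),
      (((@Finset.filter (Fin n → Bool) (fun v => v ∉ A ∧ ∃ V : Finset (Fin n → Bool),
          ((zeroVec ∈ V ∧ ∀ x ∈ V, ∀ y ∈ V, bxor x y ∈ V) ∧ (((V.card : ℝ)) ^ 2 = (2 : ℝ) ^ n) ∧
            ∀ u ∈ V, ∀ w ∈ V, ∀ x, D u w x = false) ∧ A ⊆ V ∧ v ∈ V ∧
          ∀ s ∈ V, ∀ u ∈ B, (univ.filter fun i => s i && u i).card.bodd = false) (Classical.decPred _)
        (univ.filter fun v : Fin n → Bool => (∀ s ∈ A, ∀ x, D s v x = false) ∧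
          (∀ u ∈ B, (univ.filter fun i => u i && v i).card.bodd = false) ∧
          ∀ j, ∀ y z : Fin n → Bool, (D (xs j) v z ^^ D (xs j) v (bxor z y)) = false)).card : ℝ) /
      ((univ.filter fun v : Fin n → Bool => (∀ s ∈ A, ∀ x, D s v x = false) ∧
          (∀ u ∈ B, (univ.filter fun i => u i && v i).card.bodd = false) ∧
          ∀ j, ∀ y z : Fin n → Bool, (D (xs j) v z ^^ D (xs j) v (bxor z y)) = false).card : ℝ))) := by
  classical
  have hPinj : Function.Injective P := fun x y h => by
    have := congrArg Pi h; rwa [hPiP, hPiP] at this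
  have hPiinj : Function.Injective Pi := fun x y h => by
    have := congrArg P h; rwa [hPPi, hPPi] at this
  -- the bijection of probe tuples `xs ↦ P ∘ xs`
  let eP : (Fin n → Bool) ≃ (Fin n → Bool) := ⟨P, Pi, hPiP, hPPi⟩
  let eX : (Fin r → (Fin n → Bool)) ≃ (Fin r → (Fin n → Bool)) := Equiv.arrowCongr (Equiv.refl _) eP
  refine Fintype.sum_equiv eX _ _ fun xs => ?_
  have exs : ∀ j, eX xs j = P (xs j) := fun j => rfl
  -- the candidate spaces correspond under `P⁻¹`
  have hK : ∀ v, v ∈ (univ.filter fun v : Fin n → Bool => (∀ s ∈ A₀, ∀ x, D₀ s v x = false) ∧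
          (∀ u ∈ B₀, (univ.filter fun i => u i && v i).card.bodd = false) ∧
          ∀ j, ∀ y z : Fin n → Bool, (D₀ (xs j) v z ^^ D₀ (xs j) v (bxor z y)) = false) ↔
        P v ∈ (univ.filter fun v : Fin n → Bool => (∀ s ∈ A, ∀ x, D s v x = false) ∧
          (∀ u ∈ B, (univ.filter fun i => u i && v i).card.bodd = false) ∧
          ∀ j, ∀ y z : Fin n → Bool, (D (eX xs j) v z ^^ D (eX xs j) v (bxor z y)) = false) := by
    intro v
    simp only [mem_filter, mem_univ, true_and, exs]
    exact kconds_transport D D₀ H hP hPPi hQ hA₀ hB₁ hB₂ xs v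
  have hKimg : (univ.filter fun v : Fin n → Bool => (∀ s ∈ A₀, ∀ x, D₀ s v x = false) ∧
          (∀ u ∈ B₀, (univ.filter fun i => u i && v i).card.bodd = false) ∧
          ∀ j, ∀ y z : Fin n → Bool, (D₀ (xs j) v z ^^ D₀ (xs j) v (bxor z y)) = false) =
      (univ.filter fun v : Fin n → Bool => (∀ s ∈ A, ∀ x, D s v x = false) ∧
          (∀ u ∈ B, (univ.filter fun i => u i && v i).card.bodd = false) ∧
          ∀ j, ∀ y z : Fin n → Bool, (D (eX xs j) v z ^^ D (eX xs j) v (bxor z y)) = false).image Pi := by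
    ext v
    rw [hK, mem_image]
    constructor
    · intro h; exact ⟨P v, h, hPiP v⟩
    · rintro ⟨w, hw, rfl⟩; rw [hPPi]; exact hw
  -- the new-good parts correspond under `P⁻¹`
  have hNA : ∀ v, v ∉ A₀ ↔ P v ∉ A := fun v => not_congr (hA₀ v)
  have hG := good_transport D D₀ H hP hPPi hPiP hQ hA₀ hB₁ hB₂
  have hNimg : (@Finset.filter (Fin n → Bool) (fun v => v ∉ A₀ ∧ ∃ V : Finset (Fin n → Bool),
          ((zeroVec ∈ V ∧ ∀ x ∈ V, ∀ y ∈ V, bxor x y ∈ V) ∧ (((V.card : ℝ)) ^ 2 = (2 : ℝ) ^ n) ∧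
            ∀ u ∈ V, ∀ w ∈ V, ∀ x, D₀ u w x = false) ∧ A₀ ⊆ V ∧ v ∈ V ∧
          ∀ s ∈ V, ∀ u ∈ B₀, (univ.filter fun i => s i && u i).card.bodd = false) (Classical.decPred _)
        (univ.filter fun v : Fin n → Bool => (∀ s ∈ A₀, ∀ x, D₀ s v x = false) ∧
          (∀ u ∈ B₀, (univ.filter fun i => u i && v i).card.bodd = false) ∧
          ∀ j, ∀ y z : Fin n → Bool, (D₀ (xs j) v z ^^ D₀ (xs j) v (bxor z y)) = false)) =
      (@Finset.filter (Fin n → Bool) (fun v => v ∉ A ∧ ∃ V : Finset (Fin n → Bool),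
          ((zeroVec ∈ V ∧ ∀ x ∈ V, ∀ y ∈ V, bxor x y ∈ V) ∧ (((V.card : ℝ)) ^ 2 = (2 : ℝ) ^ n) ∧
            ∀ u ∈ V, ∀ w ∈ V, ∀ x, D u w x = false) ∧ A ⊆ V ∧ v ∈ V ∧
          ∀ s ∈ V, ∀ u ∈ B, (univ.filter fun i => s i && u i).card.bodd = false) (Classical.decPred _)
        (univ.filter fun v : Fin n → Bool => (∀ s ∈ A, ∀ x, D s v x = false) ∧
          (∀ u ∈ B, (univ.filter fun i => u i && v i).card.bodd = false) ∧
          ∀ j, ∀ y z : Fin n → Bool, (D (eX xs j) v z ^^ D (eX xs j) v (bxor z y)) = false)).image Pi := by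
    ext v
    rw [@mem_filter _ _ (Classical.decPred _), mem_image, hK, hNA, hG]
    constructor
    · rintro ⟨hk, hg⟩
      exact ⟨P v, (@mem_filter _ _ (Classical.decPred _) _ _).2 ⟨hk, hg⟩, hPiP v⟩
    · rintro ⟨w, hw, rfl⟩
      rw [hPPi]
      exact (@mem_filter _ _ (Classical.decPred _) _ _).1 hw
  rw [hNimg, hKimg, card_image_of_injective _ hPiinj, card_image_of_injective _ hPiinj]

end Covariance

/-- **Orbit transport of the good mass** (tree vocabulary). For `f₀ x = f (P x ⊕ z₀) ⊕ λ x` with `P` an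
additive bijection (inverse `Pi`, adjoint `Q`), `λ` additive, and pairs with `A₀ = P⁻¹ A` (as `v ∈ A₀ ↔ P v ∈ A`),
`B₀ = Q B`: `goodMass f₀ A₀ B₀ r = goodMass f A B r` for every `r`. [cite: Carlet2020, §2.2.2] -/
theorem goodMass_transport {n : ℕ} (f f₀ : (Fin n → Bool) → Bool) (P Pi Q : (Fin n → Bool) → (Fin n → Bool))
    (z₀ : Fin n → Bool) (lam : (Fin n → Bool) → Bool)
    (hP : ∀ x y, P (bxor x y) = bxor (P x) (P y)) (hPPi : ∀ x, P (Pi x) = x) (hPiP : ∀ x, Pi (P x) = x)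
    (hQ : ∀ x y, (univ.filter fun i => P x i && y i).card.bodd = (univ.filter fun i => x i && Q y i).card.bodd)
    (hlam : ∀ x y, lam (bxor x y) = (lam x ^^ lam y)) (hf₀ : ∀ x, f₀ x = (f (bxor (P x) z₀) ^^ lam x))
    (A B A₀ B₀ : Finset (Fin n → Bool)) (hA₀ : ∀ v, v ∈ A₀ ↔ P v ∈ A)
    (hB₁ : ∀ u ∈ B, Q u ∈ B₀) (hB₂ : ∀ u ∈ B₀, ∃ u' ∈ B, Q u' = u) (r : ℕ) :
    (∑ xs : Fin (r) → (Fin n → Bool), (((@Finset.filter (Fin n → Bool) (fun v => v ∉ A₀ ∧ (∃ V : Finset (Fin n → Bool), ((zeroVec ∈ V ∧ ∀ x ∈ V, ∀ y ∈ V, bxor x y ∈ V) ∧ (((V).card : ℝ) ^ 2 = (2 : ℝ) ^ n) ∧ ∀ u ∈ V, ∀ v ∈ V, ∀ x, (f₀ x ^^ f₀ (bxor x u) ^^ f₀ (bxor x v) ^^ f₀ (bxor x (bxor u v))) = false) ∧ A₀ ⊆ V ∧ v ∈ V ∧ (∀ s ∈ V, ∀ u ∈ B₀, ((Finset.univ.filter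 fun i => s i && u i).card).bodd = false))) (Classical.decPred _) (Finset.univ.filter fun (v : Fin n → Bool) => (∀ s ∈ A₀, ∀ x, (f₀ x ^^ f₀ (bxor x s) ^^ f₀ (bxor x v) ^^ f₀ (bxor x (bxor s v))) = false) ∧ (∀ u ∈ B₀, ((Finset.univ.filter fun i => u i && v i).card).bodd = false) ∧ ∀ j, (∀ y z : Fin n → Bool, ((f₀ z ^^ f₀ (bxor z (xs j)) ^^ f₀ (bxor z v) ^^ f₀ (bxor z (bxor (xs j) v))) ^^ (f₀ (bxor z y) ^^ f₀ (bxor (bxor z y) (xs j)) ^^ f₀ (bxor (bxor z y) v) ^^ f₀ (bxor (bxor z y) (bxor (xs j) v)))) = false))).card : ℝ) / (((Finset.univ.filter fun (v : Fin n → Bool) => (∀ s ∈ A₀, ∀ x, (f₀ x ^^ f₀ (bxor x s) ^^ f₀ (bxor x v) ^^ f₀ (bxor x (bxor s v))) = false) ∧ (∀ u ∈ B₀, ((Finset.univ.filter fun i => u i && v i).card).bodd = false) ∧ ∀ j, (∀ y z : Fin n → Bool, ((f₀ z ^^ f₀ (bxor z (xs j)) ^^ f₀ (bxor z v) ^^ f₀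 (bxor z (bxor (xs j) v))) ^^ (f₀ (bxor z y) ^^ f₀ (bxor (bxor z y) (xs j)) ^^ f₀ (bxor (bxor z y) v) ^^ f₀ (bxor (bxor z y) (bxor (xs j) v)))) = false))).card : ℝ))) =
    (∑ xs : Fin (r) → (Fin n → Bool), (((@Finset.filter (Fin n → Bool) (fun v => v ∉ A ∧ (∃ V : Finset (Fin n → Bool), ((zeroVec ∈ V ∧ ∀ x ∈ V, ∀ y ∈ V, bxor x y ∈ V) ∧ (((V).card : ℝ) ^ 2 = (2 : ℝ) ^ n) ∧ ∀ u ∈ V, ∀ v ∈ V, ∀ x, (f x ^^ f (bxor x u) ^^ f (bxor x v) ^^ f (bxor x (bxor u v))) = false) ∧ A ⊆ V ∧ v ∈ V ∧ (∀ s ∈ V, ∀ u ∈ B, ((Finset.univ.filter fun i => s i && u i).card).bodd = false))) (Classical.decPred _) (Finset.univ.filter fun (v : Fin n → Bool) => (∀ s ∈ A, ∀ x, (f x ^^ f (bxor x s) ^^ f (bxor x v) ^^ f (bxor x (bxor s v))) = false) ∧ (∀ u ∈ B, ((Finset.univ.filter fun i => u i && v i).card).bodd = false) ∧ ∀ j,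 (∀ y z : Fin n → Bool, ((f z ^^ f (bxor z (xs j)) ^^ f (bxor z v) ^^ f (bxor z (bxor (xs j) v))) ^^ (f (bxor z y) ^^ f (bxor (bxor z y) (xs j)) ^^ f (bxor (bxor z y) v) ^^ f (bxor (bxor z y) (bxor (xs j) v)))) = false))).card : ℝ) / (((Finset.univ.filter fun (v : Fin n → Bool) => (∀ s ∈ A, ∀ x, (f x ^^ f (bxor x s) ^^ f (bxor x v) ^^ f (bxor x (bxor s v))) = false) ∧ (∀ u ∈ B, ((Finset.univ.filter fun i => u i && v i).card).bodd = false) ∧ ∀ j, (∀ y z : Fin n → Bool, ((f z ^^ f (bxor z (xs j)) ^^ f (bxor z v) ^^ f (bxor z (bxor (xs j) v))) ^^ (f (bxor z y) ^^ f (bxor (bxor z y) (xs j)) ^^ f (bxor (bxor z y) v) ^^ f (bxor (bxor z y) (bxor (xs j) v)))) = false))).card : ℝ))) := by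
  have key := Covariance.goodMass_transport_D
    (fun u v x => (f x ^^ f (bxor x u) ^^ f (bxor x v) ^^ f (bxor x (bxor u v))))
    (fun u v x => (f₀ x ^^ f₀ (bxor x u) ^^ f₀ (bxor x v) ^^ f₀ (bxor x (bxor u v))))
    (Covariance.D2_transport hP hlam hf₀ _ _ (fun _ _ _ => rfl) (fun _ _ _ => rfl))
    hP hPPi hPiP hQ hA₀ hB₁ hB₂ r
  exact key

/-- **Goodness is covariant** (registered brick `coreReduction_goodTransport` of stub `stub_coreReduction`, one-line
form of `Covariance.good_transport`; the file's main identity `goodMass_transport` exceeds the registry's length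
bound): with `D₀ u v x = D (P u) (P v) (P x ⊕ z₀)`, `P` an additive bijection with inverse `Pi` and adjoint `Q`,
`A₀ = P⁻¹ A`, `B₀ = Q B`, a vector `v` lies in an M-subspace for `D₀` through `A₀` orthogonal to `B₀` iff `P v` lies
in one for `D` through `A` orthogonal to `B`. [cite: Carlet2020, Prop. 54] -/
theorem coreReduction_goodTransport : ∀ {n : ℕ} (D D₀ : (Fin n → Bool) → (Fin n → Bool) → (Fin n → Bool) → Bool) (P Pi Q : (Fin n → Bool) → (Fin n → Bool)) (z₀ : Fin n → Bool) (A B A₀ B₀ : Finset (Fin n → Bool)) (v : Fin n → Bool), (∀ u v x, D₀ u v x = D (P u) (P v) (bxor (P x) z₀)) → (∀ x y, P (bxor x y) = bxor (P x) (P y)) → (∀ x, P (Pi x) = x) → (∀ x, Pi (P x) = x) → (∀ x y : Fin n → Bool, ((Finset.univ.filter fun i => P x i && y i).card).bodd = ((Finset.univ.filter fun i => x i && Q y i).card).bodd) → (∀ w, w ∈ A₀ ↔ P w ∈ A) → (∀ u ∈ B, Q u ∈ B₀) → (∀ u ∈ B₀, ∃ u' ∈ B, Q u' = u) → ((∃ V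 : Finset (Fin n → Bool), ((zeroVec ∈ V ∧ ∀ x ∈ V, ∀ y ∈ V, bxor x y ∈ V) ∧ (((V).card : ℝ) ^ 2 = (2 : ℝ) ^ n) ∧ ∀ u ∈ V, ∀ w ∈ V, ∀ x, D₀ u w x = false) ∧ A₀ ⊆ V ∧ v ∈ V ∧ (∀ s ∈ V, ∀ u ∈ B₀, ((Finset.univ.filter fun i => s i && u i).card).bodd = false)) ↔ (∃ V : Finset (Fin n → Bool), ((zeroVec ∈ V ∧ ∀ x ∈ V, ∀ y ∈ V, bxor x y ∈ V) ∧ (((V).card : ℝ) ^ 2 = (2 : ℝ) ^ n) ∧ ∀ u ∈ V, ∀ w ∈ V, ∀ x, D u w x = false) ∧ A ⊆ V ∧ P v ∈ V ∧ (∀ s ∈ V, ∀ u ∈ B, ((Finset.univ.filter fun i => s i && u i).card).bodd = false))) :=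
  fun D D₀ _ _ _ _ _ _ _ _ v H hP hPPi hPiP hQ hA₀ hB₁ hB₂ =>
    Covariance.good_transport D D₀ H hP hPPi hPiP hQ hA₀ hB₁ hB₂ v

end Summit.QuantumAdvantage.QuantumAdvantage.Theorems.SignedExactCubicForrelationNotPrBPP

end
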